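import Literature.MathematicalPhysics.QuantumLattice.SectorPartitionOfUnityCircle
import Literature.MathematicalPhysics.QuantumLattice.ScaleCutoffs
import Literature.MathematicalPhysics.QuantumLattice.HubbardFermiCurve
import Literature.Analysis.SpecialFunctions.PeriodicArgComp
import Mathlib.Analysis.SpecialFunctions.Sqrt
import HarnessLib

/-!
# The anisotropic sector cutoffs `F_{h,ω}(k) = f_h(k) ζ_{h,ω}(θ)` (Benfatto–Giuliani–Mastropietro 2006, (2.46))

Topic `Literature/MathematicalPhysics/QuantumLattice`; assembles `ScaleCutoffs.lean` (the
Gallavotti–Nicolò single-scale cutoff `f_h = gnShell γ e₀ h`, `γ = 4`), `SectorPartitionOfUnityCircle.lean`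
(the angular partition of unity `ζ̃_{n,ω} = sectorWeightCirc n ω` on the circle, `2^{n+1}` sectors
of width `π/2^n = πγ^{h/2}`, `n = -h`) and `PeriodicArgComp.lean` (smooth periodic functions of the
polar angle are smooth off the origin).

BGM 2006, §2.5 (p. 10 of the arXiv text): "We also introduce the support function
`F_{h,ω}(k) = f_h(k) ζ_{h,ω}(θ)`, where, if `k = (k₀, k⃗)`, then `θ` is the polar angle of `k⃗`. We
shall call the functions `F_{h,ω}(k)` the anisotropic support functions and the indices `ω ∈ O_h`
the anisotropic sector indices"; here `f_h(k) = H₀(γ^{-h}|-ik₀ + ε(k⃗) - μ|) - H₀(γ^{-h+1}|…|)`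
((2.28) with the fixed dispersion `ε(k⃗) = -2(cos k₁ + cos k₂)` = `sqDispersion`, i.e. the
`E_h ≡ ε` case — `TODO(general form)` in `ScaleCutoffs.lean`) and
`|-ik₀ + e| = √(k₀² + e²)`. PROVED:

* `polarAngle k⃗ = arg(k₁ + ik₂)` and the smoothness of `k⃗ ↦ ζ̃_{n,ω}(θ(k⃗))` off the origin
  (`contDiffAt_sectorWeightCirc_polarAngle`);
* `scaleCutoffFn e₀ μ n (k₀, k⃗) = f_{-n}(√(k₀² + (ε(k⃗)-μ)²))` is smooth on all of `ℝ × ℝ²`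
  (`contDiff_scaleCutoffFn`: `f_h` vanishes near `t = 0`, so the square root costs nothing), and
  the **scale support** `f ≠ 0 ⟹ e₀γ^{h-2} < √(k₀² + (ε-μ)²) < e₀γ^h`;
* `anisotropicCutoff e₀ μ n ω (k₀, k⃗) = F_{h,ω}(k)`: `[0,1]`-valued, the **sector decomposition**
  `Σ_{ω<2^{n+1}} F_{h,ω} = f_h` (`sum_anisotropicCutoff`), the **scale and angular supports**
  (`anisotropicCutoff_ne_zero_scale`, `_angle`: `F_{h,ω}(k) ≠ 0 ⟹ |θ(k⃗) - θ_{h,ω} - 2πj| < 3πγ^{h/2}/4`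
  for some `j`), and **smoothness on `ℝ × ℝ²`** when `e₀ < 4 + μ` (`contDiff_anisotropicCutoff`:
  near `k⃗ = 0` the scale cutoff vanishes because `|ε(0) - μ| = 4 + μ > e₀ ≥ e₀γ^h`).

Everything is PROVED; the three definitions have bodies.

## Sources

* G. Benfatto, A. Giuliani, V. Mastropietro, Ann. Henri Poincaré 7 (2006) 809–898, §2.5
  (2.44)–(2.46), with (2.9), (2.28) (arXiv:cond-mat/0507686 pp. 6–7, 10). [BenfattoGiulianiMastropietro2006]
* G. Benfatto, A. Giuliani, V. Mastropietro, Ann. Henri Poincaré 4 (2003) 137–193, (2.9)–(2.10)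
  (the same sectors for a fixed Fermi curve). [BenfattoGiulianiMastropietro2003]
-/

noncomputable section

open Real Set Filter Complex
open scoped Topology

namespace Literature.MathematicalPhysics.QuantumLattice

/-! ### The polar angle of a planar momentum -/

/-- The complex number `k₁ + ik₂` attached to a planar momentum. [folklore] -/
def momToComplex (k : Fin 2 → ℝ) : ℂ := equivRealProdCLM.symm (k 0, k 1)

/-- `Re(k₁ + ik₂) = k₁`. [folklore] -/
@[simp] theorem momToComplex_re (k : Fin 2 → ℝ) : (momToComplex k).re = k 0 := by simp [momToComplex]

/-- `Im(k₁ + ik₂) = k₂`. [folklore] -/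
@[simp] theorem momToComplex_im (k : Fin 2 → ℝ) : (momToComplex k).im = k 1 := by simp [momToComplex]

/-- `momToComplex` is smooth (it is continuous linear). [folklore] -/
theorem contDiff_momToComplex {m : WithTop ℕ∞} : ContDiff ℝ m momToComplex :=
  equivRealProdCLM.symm.contDiff.comp
    ((contDiff_apply ℝ ℝ (0 : Fin 2)).prodMk (contDiff_apply ℝ ℝ (1 : Fin 2)))

/-- `momToComplex k = 0 ↔ k = 0`. [folklore] -/
theorem momToComplex_eq_zero_iff (k : Fin 2 → ℝ) : momToComplex k = 0 ↔ k = 0 := by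
  constructor
  · intro h
    have h0 := congrArg Complex.re h
    have h1 := congrArg Complex.im h
    simp only [momToComplex_re, momToComplex_im, Complex.zero_re, Complex.zero_im] at h0 h1
    ext i; fin_cases i <;> simp [h0, h1]
  · rintro rfl; apply Complex.ext <;> simp

/-- **The polar angle** `θ(k⃗) = arg(k₁ + ik₂) ∈ (-π, π]` of a planar momentum. [cite: BenfattoGiulianiMastropietro2006, §2.5 (2.46)] -/
def polarAngle (k : Fin 2 → ℝ) : ℝ := arg (momToComplex k)

/-- Polar coordinates: `k₁ = |k⃗| cos θ(k⃗)`. [folklore] -/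
theorem norm_mul_cos_polarAngle (k : Fin 2 → ℝ) : ‖momToComplex k‖ * Real.cos (polarAngle k) = k 0 := by
  rw [polarAngle, norm_mul_cos_arg, momToComplex_re]

/-- Polar coordinates: `k₂ = |k⃗| sin θ(k⃗)`. [folklore] -/
theorem norm_mul_sin_polarAngle (k : Fin 2 → ℝ) : ‖momToComplex k‖ * Real.sin (polarAngle k) = k 1 := by
  rw [polarAngle, norm_mul_sin_arg, momToComplex_im]

/-- **The angular cutoffs are smooth functions of the momentum off the origin**:
`k⃗ ↦ ζ̃_{n,ω}(θ(k⃗))` is `C^∞` at every `k⃗ ≠ 0`. [cite: BenfattoGiulianiMastropietro2006, §2.5 (2.45)–(2.46)] -/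
theorem contDiffAt_sectorWeightCirc_polarAngle (n : ℕ) (ω : ℤ) {k : Fin 2 → ℝ} (hk : k ≠ 0) {m : ℕ∞} :
    ContDiffAt ℝ m (fun q => sectorWeightCirc n ω (polarAngle q)) k := by
  have hz : momToComplex k ≠ 0 := fun h => hk ((momToComplex_eq_zero_iff k).1 h)
  have h := (contDiff_sectorWeightCirc n ω (m := m)).contDiffAt_comp_arg (periodic_sectorWeightCirc n ω) hz
  exact h.comp k contDiff_momToComplex.contDiffAt

/-! ### The scale cutoff as a function of `(k₀, k⃗)` -/

/-- Composition of a smooth function vanishing near `0⁺` with the square root is smooth: if `g` is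
`C^m` and `g(t) = 0` for `t ≤ a` with `a > 0`, then `q ↦ g(√q)` is `C^m` on `ℝ`. [folklore] -/
theorem contDiff_comp_sqrt_of_eq_zero {g : ℝ → ℝ} {m : ℕ∞} (hg : ContDiff ℝ m g) {a : ℝ} (ha : 0 < a)
    (h0 : ∀ t ≤ a, g t = 0) : ContDiff ℝ m fun q => g (Real.sqrt q) := by
  refine contDiff_iff_contDiffAt.2 fun q₀ => ?_
  by_cases hq : 0 < q₀
  · exact hg.contDiffAt.comp q₀ (Real.contDiffAt_sqrt hq.ne')
  · -- near `q₀ ≤ 0` the function vanishes identically (`√q < a` for `q < a²`)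
    have hev : (fun q => g (Real.sqrt q)) =ᶠ[𝓝 q₀] fun _ => 0 := by
      have : Iio (a ^ 2) ∈ 𝓝 q₀ := Iio_mem_nhds (lt_of_le_of_lt (not_lt.1 hq) (by positivity))
      filter_upwards [this] with q hq'
      apply h0
      rw [← Real.sqrt_sq ha.le]
      exact Real.sqrt_le_sqrt hq'.le
    exact (contDiffAt_const (c := (0 : ℝ))).congr_of_eventuallyEq hev

/-- **The single-scale cutoff as a function of the momentum** (`γ = 4`, scale `h = -n`):
`f_{-n}(k) = gnShell 4 e₀ (-n) (√(k₀² + (ε(k⃗) - μ)²))`. [cite: BenfattoGiulianiMastropietro2006, §2.3 (2.28)] -/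
def scaleCutoffFn (e₀ μ : ℝ) (n : ℕ) (p : ℝ × (Fin 2 → ℝ)) : ℝ :=
  gnShell 4 e₀ (-(n : ℤ)) (Real.sqrt (p.1 ^ 2 + (sqDispersion p.2 - μ) ^ 2))

/-- `ε` is smooth. [folklore] -/
theorem contDiff_sqDispersion {m : WithTop ℕ∞} : ContDiff ℝ m sqDispersion := by
  unfold sqDispersion
  fun_prop

/-- **`f_h(k)` is smooth on all of `ℝ × ℝ²`.** [cite: BenfattoGiulianiMastropietro2006, §2.3 (2.28)] -/
theorem contDiff_scaleCutoffFn {e₀ μ : ℝ} (he : 0 < e₀) (n : ℕ) {m : ℕ∞} : ContDiff ℝ m (scaleCutoffFn e₀ μ n) := by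
  have hγ : (1 : ℝ) < 4 := by norm_num
  have ha : 0 < e₀ * (4 : ℝ) ^ (-(n : ℤ) - 2) := mul_pos he (zpow_pos (by norm_num) _)
  have hcomp := contDiff_comp_sqrt_of_eq_zero (contDiff_gnShell 4 e₀ (-(n : ℤ)) (m := m)) ha
    (fun t ht => gnShell_eq_zero_of_le hγ he ht)
  unfold scaleCutoffFn
  exact hcomp.comp ((contDiff_fst.pow 2).add (((contDiff_sqDispersion.comp contDiff_snd).sub contDiff_const).pow 2))

/-- `0 ≤ f_h(k) ≤ 1`. [folklore] -/
theorem scaleCutoffFn_mem_Icc {e₀ μ : ℝ} (he : 0 < e₀) (n : ℕ) (p : ℝ × (Fin 2 → ℝ)) :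
    scaleCutoffFn e₀ μ n p ∈ Icc (0 : ℝ) 1 :=
  ⟨gnShell_nonneg (by norm_num) he _ (Real.sqrt_nonneg _), gnShell_le_one _ _ _ _⟩

/-- **Scale support**: `f_h(k) ≠ 0 ⟹ e₀γ^{h-2} < |-ik₀ + ε(k⃗) - μ| < e₀γ^h`. [cite: BenfattoGiulianiMastropietro2006, §2.3 (2.28)] -/
theorem scaleCutoffFn_ne_zero {e₀ μ : ℝ} (he : 0 < e₀) {n : ℕ} {p : ℝ × (Fin 2 → ℝ)} (h : scaleCutoffFn e₀ μ n p ≠ 0) :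
    Real.sqrt (p.1 ^ 2 + (sqDispersion p.2 - μ) ^ 2) ∈
      Ioo (e₀ * (4 : ℝ) ^ (-(n : ℤ) - 2)) (e₀ * (4 : ℝ) ^ (-(n : ℤ))) :=
  mem_Ioo_of_gnShell_ne_zero (by norm_num) he h

/-! ### The anisotropic cutoffs -/

/-- **The anisotropic support function** `F_{h,ω}(k) = f_h(k) ζ̃_{h,ω}(θ(k⃗))` (scale `h = -n`,
sector `ω`, `γ = 4`). [cite: BenfattoGiulianiMastropietro2006, §2.5 (2.46)] -/
def anisotropicCutoff (e₀ μ : ℝ) (n : ℕ) (ω : ℤ) (p : ℝ × (Fin 2 → ℝ)) : ℝ :=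
  scaleCutoffFn e₀ μ n p * sectorWeightCirc n ω (polarAngle p.2)

/-- `0 ≤ F_{h,ω} ≤ 1`. [folklore] -/
theorem anisotropicCutoff_mem_Icc {e₀ μ : ℝ} (he : 0 < e₀) (n : ℕ) (ω : ℤ) (p : ℝ × (Fin 2 → ℝ)) :
    anisotropicCutoff e₀ μ n ω p ∈ Icc (0 : ℝ) 1 := by
  have h1 := scaleCutoffFn_mem_Icc he n p (μ := μ)
  have h2 := sectorWeightCirc_nonneg n ω (polarAngle p.2)
  have h3 := sectorWeightCirc_le_one n ω (polarAngle p.2)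
  exact ⟨mul_nonneg h1.1 h2, mul_le_one₀ h1.2 h2 h3⟩

/-- **The sector decomposition of the scale cutoff**: `Σ_{ω<2^{n+1}} F_{h,ω}(k) = f_h(k)`. [cite: BenfattoGiulianiMastropietro2006, §2.5 (2.45)–(2.46)] -/
theorem sum_anisotropicCutoff (e₀ μ : ℝ) (n : ℕ) (p : ℝ × (Fin 2 → ℝ)) :
    ∑ ω ∈ Finset.range (sectorCount n), anisotropicCutoff e₀ μ n ω p = scaleCutoffFn e₀ μ n p := by
  simp only [anisotropicCutoff, ← Finset.mul_sum, sum_sectorWeightCirc_eq_one, mul_one]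

/-- Scale support of `F_{h,ω}`. [cite: BenfattoGiulianiMastropietro2006, §2.5 (2.46)] -/
theorem anisotropicCutoff_ne_zero_scale {e₀ μ : ℝ} (he : 0 < e₀) {n : ℕ} {ω : ℤ} {p : ℝ × (Fin 2 → ℝ)}
    (h : anisotropicCutoff e₀ μ n ω p ≠ 0) :
    Real.sqrt (p.1 ^ 2 + (sqDispersion p.2 - μ) ^ 2) ∈
      Ioo (e₀ * (4 : ℝ) ^ (-(n : ℤ) - 2)) (e₀ * (4 : ℝ) ^ (-(n : ℤ))) :=
  scaleCutoffFn_ne_zero he (left_ne_zero_of_mul h)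

/-- **Angular support of `F_{h,ω}`**: `F_{h,ω}(k) ≠ 0 ⟹ |θ(k⃗) - θ_{h,ω} - 2πj| < 3w_n/4` for some
integer `j` (`θ_{h,ω} = (ω + ½)w_n`, `w_n = π/2^n = πγ^{h/2}`). [cite: BenfattoGiulianiMastropietro2006, §2.5 (2.45)–(2.46)] -/
theorem anisotropicCutoff_ne_zero_angle {e₀ μ : ℝ} {n : ℕ} {ω : ℤ} {p : ℝ × (Fin 2 → ℝ)}
    (h : anisotropicCutoff e₀ μ n ω p ≠ 0) :
    ∃ j : ℤ, |polarAngle p.2 - ((ω : ℝ) + 1 / 2) * sectorWidth n - 2 * π * j| < 3 * sectorWidth n / 4 := by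
  by_contra hc
  push Not at hc
  exact (right_ne_zero_of_mul h) (sectorWeightCirc_eq_zero hc)

/-- Away from the Fermi region's centre: if `e₀ < 4 + μ` then `f_h` vanishes near `k⃗ = 0`
(`|ε(0) - μ| = 4 + μ`). [folklore] -/
theorem scaleCutoffFn_eventuallyEq_zero {e₀ μ : ℝ} (he : 0 < e₀) (heμ : e₀ < 4 + μ) (n : ℕ) (k₀ : ℝ) :
    ∀ᶠ q : ℝ × (Fin 2 → ℝ) in 𝓝 (k₀, 0), scaleCutoffFn e₀ μ n q = 0 := by
  -- the open set where `|ε(k⃗) - μ| > e₀`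
  have hopen : IsOpen {q : ℝ × (Fin 2 → ℝ) | e₀ < |sqDispersion q.2 - μ|} :=
    isOpen_lt continuous_const ((continuous_sqDispersion.comp continuous_snd).sub continuous_const).abs
  have hmem : ((k₀, (0 : Fin 2 → ℝ)) : ℝ × (Fin 2 → ℝ)) ∈ {q : ℝ × (Fin 2 → ℝ) | e₀ < |sqDispersion q.2 - μ|} := by
    simp only [mem_setOf_eq, sqDispersion_zero]
    rw [abs_of_neg (by linarith)]
    linarith
  filter_upwards [hopen.mem_nhds hmem] with q hq
  apply gnShell_eq_zero_of_ge (by norm_num) he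
  have h1 : (4 : ℝ) ^ (-(n : ℤ)) ≤ 1 := zpow_le_one_of_nonpos₀ (by norm_num) (by omega)
  calc e₀ * (4 : ℝ) ^ (-(n : ℤ)) ≤ e₀ * 1 := mul_le_mul_of_nonneg_left h1 he.le
    _ ≤ |sqDispersion q.2 - μ| := by rw [mul_one]; exact le_of_lt hq
    _ = Real.sqrt ((sqDispersion q.2 - μ) ^ 2) := (Real.sqrt_sq_eq_abs _).symm
    _ ≤ Real.sqrt (q.1 ^ 2 + (sqDispersion q.2 - μ) ^ 2) := Real.sqrt_le_sqrt (by nlinarith)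

/-- **`F_{h,ω}` is smooth on `ℝ × ℝ²`** (for `0 < e₀ < 4 + μ`): off `k⃗ = 0` it is a product of
smooth functions, and near `k⃗ = 0` it vanishes identically. [cite: BenfattoGiulianiMastropietro2006, §2.5 (2.46)] -/
theorem contDiff_anisotropicCutoff {e₀ μ : ℝ} (he : 0 < e₀) (heμ : e₀ < 4 + μ) (n : ℕ) (ω : ℤ) {m : ℕ∞} :
    ContDiff ℝ m (anisotropicCutoff e₀ μ n ω) := by
  refine contDiff_iff_contDiffAt.2 fun p => ?_
  by_cases hk : p.2 = 0
  · -- near `k⃗ = 0`: identically zero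
    have hev : anisotropicCutoff e₀ μ n ω =ᶠ[𝓝 p] fun _ => 0 := by
      have h := scaleCutoffFn_eventuallyEq_zero he heμ n p.1
      rw [← hk] at h
      filter_upwards [h] with q hq
      rw [anisotropicCutoff, hq, zero_mul]
    exact (contDiffAt_const (c := (0 : ℝ))).congr_of_eventuallyEq hev
  · exact (contDiff_scaleCutoffFn he n).contDiffAt.mul
      ((contDiffAt_sectorWeightCirc_polarAngle n ω hk).comp p contDiff_snd.contDiffAt)

end Literature.MathematicalPhysics.QuantumLattice

end
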